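import Literature.MathematicalPhysics.QuantumLattice.InfVolFermionStateConstrainedMinimisers
import Literature.MathematicalPhysics.QuantumLattice.InequivalentLayerStackingTransport
import HarnessLib

/-!
# Periodic ground states of superlattice models EXIST: the cell energy attains its infimum over the periodic
# states and over the periodic states of prescribed cell filling; every periodic ground state of an
# inequivalent-plane crystal is, plane by plane, a near ground state of its own plane

Topic `Literature/MathematicalPhysics/QuantumLattice` (namespace = path; family `hubbard`). The superlattice twin of
`InfVolFermionStateConstrainedMinimisers` (translation-invariant constraint classes): there the mean energy of any
finite-range interaction attains its infimum on every non-empty weak-⋆ sequentially closed class (weak-⋆ sequential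
compactness of the state space, `exists_tendsto_expect_subseq`); here the same for the CELL ENERGY of a family of
views (`SuperlatticeCellEnergyFamilies`: decorated lattices, ladders, multilayer crystals) over the PERIODIC classes.
So «periodic ground state of the crystal» — the subject of the plane-by-plane theorems of
`InequivalentLayerStackingTransport` / `TrilayerHubbardTTPrimeInequivalentPlanes` with `δ = 0` — is never vacuous.

* §1 weak-⋆ limits: translates converge (`tendsto_shift_expect`), periodicity is closed
  (`isPeriodic_of_tendsto_expect`), cell energies and cell fillings converge (`tendsto_cellEnergy_of_tendsto_expect`,
  `tendsto_cellFilling_of_tendsto_expect`), the classes `periodicStates q` and `periodicStatesAt q ρ` are sequentially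
  closed (`mem_periodicStates_of_tendsto`, `mem_periodicStatesAt_of_tendsto`).
* §2 EXISTENCE: `exists_isMinOn_cellEnergy_of_seqClosed` (any non-empty sequentially closed class, any views),
  **`exists_isMinOn_cellEnergy_periodicStates`**, **`exists_isMinOn_cellEnergy_periodicStatesAt`** (every realised cell
  filling), and the attained forms `exists_cellEnergy_eq_infCellEnergyOn_periodicStates(At)`.
* §3 the inequivalent-plane crystal: **`exists_periodic_groundState_planeResolved`** (for every realised density split a
  periodic ground state of that cell filling exists) and **`IsPeriodic.meanEnergy_layerMarginal_le_of_isMinOn`**: for every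
  periodic GROUND STATE (exact minimiser at its own cell filling) each plane marginal is within `2 Σ_{j,b} |tz j b|` of its
  own plane's fixed-filling ground-state energy density — the `δ = 0` case of `IsPeriodic.meanEnergy_layerMarginal_le`.

Everything is PROVED; no definition, no named fact, no number. HONEST SCOPE: existence by compactness (no uniqueness, no
construction); `T = 0`; energies only.

## Tree / Mathlib search

REUSED: `exists_tendsto_expect_subseq`, `isTranslationInvariant_of_tendsto_expect`, `tendsto_meanEnergy_of_tendsto_expect`
(`InfVolFermionStateWeakLimits`), `tendsto_density` (`InfVolFermionStateConstrainedMinimisers`); `cellEnergy`, `cellFilling`,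
`cellFilling_eq_density_cellAverage`, `density_shiftAverage`, `infCellEnergyOn`, `bddBelow_cellEnergy_image`,
`infCellEnergyOn_le_cellEnergy`, `le_infCellEnergyOn`, `cellEnergy_eq_infCellEnergyOn_of_isMinOn`, `periodicStates(At)`
(`SuperlatticeCellEnergyFamilies` / `PeriodicStatesCellAverage`); `planeResolvedViews`, `IsPeriodic.meanEnergy_layerMarginal_le`,
`periodicStatesAt_stackPeriods_nonempty` (`InequivalentLayerStackingTransport`); Mathlib `exists_seq_tendsto_sInf`,
`tendsto_nhds_unique`, `tendsto_finsetSum`, `Filter.Tendsto.const_mul`. `lean search 'exists_isMinOn.*cellEnergy|periodicStates.*IsMinOn'`: nothing.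

## References

* O. Bratteli, A. Kishimoto, D. W. Robinson, CMP 64 (1978) 41, Thm. 2 (ground states minimise the mean energy;
  existence by compactness). [cite: BratteliKishimotoRobinson1978, Thm. 2 (condition 2)]
* O. Bratteli, D. W. Robinson, *OAQSM 1* (1987), Thm. 2.3.15 (the state space is weak-⋆ compact), §4.3.1.
  [cite: BratteliRobinsonI1987, Thm. 2.3.15]
* D. Ruelle, *Statistical Mechanics: Rigorous Results* (1969), §3.4. [cite: Ruelle1969, §3.4]
* H. Araki, H. Moriya, Rev. Math. Phys. 15 (2003) 93, §4.1 Def. 4.5 (periodic states). [cite: ArakiMoriya2003, §4.1 Def. 4.5]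
-/

noncomputable section

namespace Literature.MathematicalPhysics.QuantumLattice

open Matrix Finset HubbardWave0 Literature.Probability.LatticeModels ThermodynamicLimit
open _root_.Filter
open scoped _root_.Topology ComplexOrder BigOperators

variable {d : ℕ} {q : Fin d → ℕ}

/-! ### §1. Weak-⋆ limits of periodic states -/

namespace InfVolFermionState

variable {ωs : ℕ → InfVolFermionState d} {ω : InfVolFermionState d}

/-- **Translates converge along weak-⋆ convergent sequences** (`(ω ∘ τ_v)_Λ = ω_{Λ+v} ∘ Γ(τ_v)`).
[cite: ArakiMoriya2003, §4.1 Def. 4.5] -/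
theorem tendsto_shift_expect
    (hlim : ∀ (Λ : Finset (Site d)) (A : FermionOp Λ), Tendsto (fun j => (ωs j).expect Λ A) atTop (𝓝 (ω.expect Λ A)))
    (v : Site d) :
    ∀ (Λ : Finset (Site d)) (A : FermionOp Λ),
      Tendsto (fun j => ((ωs j).shift v).expect Λ A) atTop (𝓝 ((ω.shift v).expect Λ A)) := fun Λ A => by
  simp only [shift_expect]
  exact hlim _ _

/-- **Periodicity is closed under weak-⋆ limits.** [cite: ArakiMoriya2003, §4.1 Def. 4.5] -/
theorem isPeriodic_of_tendsto_expect
    (hlim : ∀ (Λ : Finset (Site d)) (A : FermionOp Λ), Tendsto (fun j => (ωs j).expect Λ A) atTop (𝓝 (ω.expect Λ A)))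
    (hper : ∀ j, (ωs j).IsPeriodic q) : ω.IsPeriodic q := by
  intro i
  refine InfVolFermionState.ext fun Λ => LinearMap.ext fun A => ?_
  refine tendsto_nhds_unique (tendsto_shift_expect hlim (periodVec q i) Λ A) ?_
  refine (hlim Λ A).congr' (Eventually.of_forall fun j => ?_)
  show (ωs j).expect Λ A = ((ωs j).shift (periodVec q i)).expect Λ A
  rw [hper j i]

/-- **Cell energies converge along weak-⋆ convergent sequences** (a finite combination of mean energies of
translates). [cite: BratteliKishimotoRobinson1978, §3 (mean energy functional)] -/
theorem tendsto_cellEnergy_of_tendsto_expect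
    (hlim : ∀ (Λ : Finset (Site d)) (A : FermionOp Λ), Tendsto (fun j => (ωs j).expect Λ A) atTop (𝓝 (ω.expect Λ A)))
    (M : Cell q → FermionInteraction d) (R : ℝ) :
    Tendsto (fun j => (ωs j).cellEnergy M R) atTop (𝓝 (ω.cellEnergy M R)) := by
  unfold InfVolFermionState.cellEnergy
  exact (tendsto_finsetSum _ fun n _ =>
    tendsto_meanEnergy_of_tendsto_expect (tendsto_shift_expect hlim (cellPos n)) (M n) R).const_mul _

/-- **Cell fillings converge along weak-⋆ convergent sequences.** [cite: ArakiMoriya2003, §4.1] -/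
theorem tendsto_cellFilling_of_tendsto_expect
    (hlim : ∀ (Λ : Finset (Site d)) (A : FermionOp Λ), Tendsto (fun j => (ωs j).expect Λ A) atTop (𝓝 (ω.expect Λ A))) :
    Tendsto (fun j => (ωs j).cellFilling q) atTop (𝓝 (ω.cellFilling q)) := by
  simp only [InfVolFermionState.cellFilling_eq_density_cellAverage, InfVolFermionState.cellAverage, density_shiftAverage]
  exact (tendsto_finsetSum _ fun n _ => tendsto_density (tendsto_shift_expect hlim (cellPos n))).const_mul _

/-- The periodic class is sequentially closed. [cite: ArakiMoriya2003, §4.1 Def. 4.5] -/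
theorem mem_periodicStates_of_tendsto
    (hlim : ∀ (Λ : Finset (Site d)) (A : FermionOp Λ), Tendsto (fun j => (ωs j).expect Λ A) atTop (𝓝 (ω.expect Λ A)))
    (hmem : ∀ j, ωs j ∈ periodicStates q) : ω ∈ periodicStates q :=
  isPeriodic_of_tendsto_expect hlim hmem

/-- The periodic class of prescribed cell filling is sequentially closed. [cite: Ruelle1969, §3.4] -/
theorem mem_periodicStatesAt_of_tendsto (ρ : ℝ)
    (hlim : ∀ (Λ : Finset (Site d)) (A : FermionOp Λ), Tendsto (fun j => (ωs j).expect Λ A) atTop (𝓝 (ω.expect Λ A)))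
    (hmem : ∀ j, ωs j ∈ periodicStatesAt q ρ) : ω ∈ periodicStatesAt q ρ := by
  refine ⟨isPeriodic_of_tendsto_expect hlim fun j => (hmem j).1, ?_⟩
  refine tendsto_nhds_unique (tendsto_cellFilling_of_tendsto_expect hlim) ?_
  refine (tendsto_const_nhds (x := ρ)).congr' (Eventually.of_forall fun j => ?_)
  exact (hmem j).2.symm

end InfVolFermionState

/-! ### §2. Existence of periodic minimisers -/

section Existence

/-- **The cell energy attains its infimum on every non-empty sequentially closed class** (minimising sequence,
weak-⋆ convergent subsequence, closedness, continuity of the cell energy). [cite: BratteliKishimotoRobinson1978, Thm. 2 (condition 2)] -/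
theorem exists_isMinOn_cellEnergy_of_seqClosed {S : Set (InfVolFermionState d)} (hS : S.Nonempty)
    (hclosed : ∀ (ωs : ℕ → InfVolFermionState d) (ω : InfVolFermionState d), (∀ j, ωs j ∈ S) →
      (∀ (Λ : Finset (Site d)) (A : FermionOp Λ),
        Tendsto (fun j => (ωs j).expect Λ A) atTop (𝓝 (ω.expect Λ A))) → ω ∈ S)
    (M : Cell q → FermionInteraction d) (R : ℝ) :
    ∃ ω ∈ S, IsMinOn (fun σ : InfVolFermionState d => σ.cellEnergy M R) S ω := by
  obtain ⟨u, -, hu, hmem⟩ := exists_seq_tendsto_sInf (hS.image fun σ : InfVolFermionState d =>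
    σ.cellEnergy M R) (bddBelow_cellEnergy_image S M R)
  choose ωs hωsS hωse using fun n => (Set.mem_image _ _ _).1 (hmem n)
  obtain ⟨φ, hφ, ω, hlim⟩ := InfVolFermionState.exists_tendsto_expect_subseq ωs
  have hωS : ω ∈ S := hclosed (fun j => ωs (φ j)) ω (fun j => hωsS (φ j)) hlim
  refine ⟨ω, hωS, fun σ hσ => ?_⟩
  have h1 : Tendsto (fun j => (ωs (φ j)).cellEnergy M R) atTop (𝓝 (ω.cellEnergy M R)) :=
    InfVolFermionState.tendsto_cellEnergy_of_tendsto_expect hlim M R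
  have h2 : Tendsto (fun j => (ωs (φ j)).cellEnergy M R) atTop (𝓝 (infCellEnergyOn S M R)) := by
    have h := hu.comp hφ.tendsto_atTop
    refine h.congr' (Eventually.of_forall fun j => ?_)
    simp only [Function.comp_apply, hωse]
  have heq : ω.cellEnergy M R = infCellEnergyOn S M R := tendsto_nhds_unique h1 h2
  show ω.cellEnergy M R ≤ σ.cellEnergy M R
  rw [heq]
  exact infCellEnergyOn_le_cellEnergy M R hσ

/-- **Periodic ground states exist**: the cell energy of any family of views attains its infimum over the
`q`-periodic states. [cite: BratteliKishimotoRobinson1978, Thm. 2 (condition 2)] -/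
theorem exists_isMinOn_cellEnergy_periodicStates (M : Cell q → FermionInteraction d) (R : ℝ) :
    ∃ ω ∈ periodicStates q, IsMinOn (fun σ : InfVolFermionState d => σ.cellEnergy M R) (periodicStates q) ω :=
  exists_isMinOn_cellEnergy_of_seqClosed
    ⟨_, (InfVolFermionState.vacuumState_isTranslationInvariant (d := d)).isPeriodic q⟩
    (fun _ _ hmem hlim => InfVolFermionState.mem_periodicStates_of_tendsto hlim hmem) M R

/-- **Periodic ground states of prescribed cell filling exist** (every realised cell filling).
[cite: Ruelle1969, §3.4] -/
theorem exists_isMinOn_cellEnergy_periodicStatesAt (M : Cell q → FermionInteraction d) (R : ℝ) {ρ : ℝ}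
    (hS : (periodicStatesAt q ρ).Nonempty) :
    ∃ ω ∈ periodicStatesAt q ρ, IsMinOn (fun σ : InfVolFermionState d => σ.cellEnergy M R) (periodicStatesAt q ρ) ω :=
  exists_isMinOn_cellEnergy_of_seqClosed hS
    (fun _ _ hmem hlim => InfVolFermionState.mem_periodicStatesAt_of_tendsto ρ hlim hmem) M R

/-- **The infimum over the periodic states is attained.** [cite: BratteliKishimotoRobinson1978, Thm. 2 (condition 2)] -/
theorem exists_cellEnergy_eq_infCellEnergyOn_periodicStates (M : Cell q → FermionInteraction d) (R : ℝ) :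
    ∃ ω ∈ periodicStates q, ω.cellEnergy M R = infCellEnergyOn (periodicStates q) M R := by
  obtain ⟨ω, hω, hmin⟩ := exists_isMinOn_cellEnergy_periodicStates M R
  exact ⟨ω, hω, cellEnergy_eq_infCellEnergyOn_of_isMinOn M R hω hmin⟩

/-- **The infimum over the periodic states of a realised cell filling is attained.** [cite: Ruelle1969, §3.4] -/
theorem exists_cellEnergy_eq_infCellEnergyOn_periodicStatesAt (M : Cell q → FermionInteraction d) (R : ℝ) {ρ : ℝ}
    (hS : (periodicStatesAt q ρ).Nonempty) :
    ∃ ω ∈ periodicStatesAt q ρ, ω.cellEnergy M R = infCellEnergyOn (periodicStatesAt q ρ) M R := by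
  obtain ⟨ω, hω, hmin⟩ := exists_isMinOn_cellEnergy_periodicStatesAt M R hS
  exact ⟨ω, hω, cellEnergy_eq_infCellEnergyOn_of_isMinOn M R hω hmin⟩

end Existence

/-! ### §3. Periodic ground states of the inequivalent-plane crystal -/

section Crystal

variable {ι κ : Type*} [Fintype ι] [Fintype κ] (p : ℕ)

/-- **Periodic ground states of the plane-resolved crystal exist at every realised density split**: for
translation-invariant `σ_j` of `ℤ^d` there is a periodic state of cell filling `(p+1)⁻¹ Σ_j ρ(σ_j)` minimising the
cell energy in its filling class. [cite: BratteliKishimotoRobinson1978, Thm. 2 (condition 2)] -/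
theorem exists_periodic_groundState_planeResolved (hd : 0 < d) (ε U : Fin (p + 1) → ℝ) (u : ι → Site d)
    (θ : Fin (p + 1) → ι → ℝ) (w : κ → Site (d + 1)) (tz : Fin (p + 1) → κ → ℝ) (R' : ℝ)
    {σ : Fin (p + 1) → InfVolFermionState d} (hσ : ∀ j, (σ j).IsTranslationInvariant) :
    ∃ ω ∈ periodicStatesAt (stackPeriods d p) (((p : ℝ) + 1)⁻¹ * ∑ j, (σ j).density),
      ω.cellEnergy (planeResolvedViews p ε U u θ w tz) R' =
        infCellEnergyOn (periodicStatesAt (stackPeriods d p) (((p : ℝ) + 1)⁻¹ * ∑ j, (σ j).density))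
          (planeResolvedViews p ε U u θ w tz) R' :=
  exists_cellEnergy_eq_infCellEnergyOn_periodicStatesAt _ R' (periodicStatesAt_stackPeriods_nonempty p hd hσ)

/-- **EVERY PERIODIC GROUND STATE IS, PLANE BY PLANE, A NEAR GROUND STATE OF ITS OWN PLANE** (`δ = 0`): for a
periodic `ω` minimising the cell energy at its own cell filling, each plane marginal `σ_j` satisfies
`e_{Φ_j}(σ_j) ≤ e_j(ρ(σ_j)) + 2 Σ_{j,b} |tz j b|`. [cite: BratteliKishimotoRobinson1978, Thm. 2 (condition 2)] -/
theorem InfVolFermionState.IsPeriodic.meanEnergy_layerMarginal_le_of_isMinOn {ω : InfVolFermionState (d + 1)}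
    (hω : ω.IsPeriodic (stackPeriods d p)) (hd : 0 < d) (ε U : Fin (p + 1) → ℝ) {u : ι → Site d}
    (hu : ∀ a, u a ≠ 0) (θ : Fin (p + 1) → ι → ℝ) {w : κ → Site (d + 1)} (hw : ∀ b, w b 0 ≠ 0)
    (tz : Fin (p + 1) → κ → ℝ) {R R' : ℝ} (hR : 1 ≤ R) (hRR' : R ≤ R')
    (huR : ∀ a, u a ∈ thicken ({0} : Finset (Site d)) R) (hwR' : ∀ b, w b ∈ thicken ({0} : Finset (Site (d + 1))) R')
    (hmin : IsMinOn (fun σ : InfVolFermionState (d + 1) => σ.cellEnergy (planeResolvedViews p ε U u θ w tz) R')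
      (periodicStatesAt (stackPeriods d p) (ω.cellFilling (stackPeriods d p))) ω) (j : Fin (p + 1)) :
    (ω.layerMarginal (layerCoset d j)).meanEnergy (vectorHoppingModel (U j) u (θ j)) R ≤
      (vectorHoppingModel (U j) u (θ j)).tiGroundEnergyDensityAt R ((ω.layerMarginal (layerCoset d j)).density) +
        2 * ∑ jb : Fin (p + 1) × κ, |tz jb.1 jb.2| := by
  have hmem : ω ∈ periodicStatesAt (stackPeriods d p) (ω.cellFilling (stackPeriods d p)) := ⟨hω, rfl⟩
  have hδ : ω.cellEnergy (planeResolvedViews p ε U u θ w tz) R' ≤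
      infCellEnergyOn (periodicStatesAt (stackPeriods d p) (ω.cellFilling (stackPeriods d p)))
        (planeResolvedViews p ε U u θ w tz) R' + 0 := by
    rw [add_zero, cellEnergy_eq_infCellEnergyOn_of_isMinOn _ R' hmem hmin]
  have h := hω.meanEnergy_layerMarginal_le p hd ε U hu θ hw tz hR hRR' huR hwR' hδ j
  simpa only [mul_zero, zero_add] using h

end Crystal

end Literature.MathematicalPhysics.QuantumLattice
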